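import Literature.Geometry.Riemannian.ColdingMinicozziEntropyInvariance
import Literature.Analysis.PDE.ParabolicHolderNorm
import HarnessLib

/-!
# The Gaussian density ratio `Θ(𝓜, X, r)` of a subset of spacetime (White 2005, §2.9)

Topic `Literature/Geometry/Riemannian` (vocabulary brick of the provefact unit of
`WhiteLocalRegularityCylinderFlow.lean`, next to `FlowC2AlphaNorm.lean` (`K_{2,α}`) and
`ColdingMinicozziEntropy.lean` (`gaussianArea`)).  For a subset `𝓜` of spacetime `R^{N,1}`
(`Parabolic (EuclideanSpace ℝ (Fin N))` of `Literature/Analysis/PDE/ParabolicHolderNorm.lean`),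
a point `X = (x, t)` and `r > 0`, White's **Gaussian density ratio** is
`Θ(𝓜, X, r) = ∫_{y ∈ 𝓜(t - r²)} ρ_X(y, t - r²) d𝓗^m y` with the backward heat kernel
`ρ_X(y, s) = (4π(t - s))^{-m/2} exp(-|y - x|² / 4(t - s))` (White 2005, §2.9, p. 1496, for proper
flows; the formula makes sense for any subset), i.e. the Gaussian area
`gaussianArea m x (r²) (𝓜(t - r²))` of the TIME SLICE `𝓜(t - r²) = {y : (y, t - r²) ∈ 𝓜}`
(White §2.2).  This is exactly the quantity bounded by `1 + ε` in the hypothesis of the fact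
`White2005_localRegularity_cylinderFlowSheet` (`gaussianDensityRatio_track`).

Definitions: `ParabolicFlow.timeSlice`, `ParabolicFlow.gaussianDensityRatio`.  Proved:
monotonicity in the set, the slices of translates and parabolic dilates, and the invariances
`Θ(𝓜 + Z, X + Z, r) = Θ(𝓜, X, r)`, `Θ(D_c 𝓜, D_c X, c r) = Θ(𝓜, X, r)` (White §2.9: "Θ is scale
invariant"), from `gaussianArea_image_isometryEquiv` / `gaussianArea_smul`
(`ColdingMinicozziEntropyInvariance.lean`), and the model case of White's rigidity statement
§2.10: a STATIC `m`-PLANE `S × J` has `Θ ≤ 1` everywhere and `Θ = 1` at its points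
(`gaussianDensityRatio_staticPlane_le_one/eq_one`, from `gaussianArea_affineSubspace`).  NOT here:
Huisken's monotonicity (Θ increasing in `r` for mean curvature flows, White (2.9)), the density
`Θ(𝓜, X) = lim_{r → 0} Θ(𝓜, X, r)`, and its upper semicontinuity.

## References

* [White2005] B. White, *A local regularity theorem for mean curvature flow*, Ann. of Math. (2)
  161 (2005), 1487–1519, §2.2 (time slices), §2.9 (Gaussian density), p. 1496.
-/

noncomputable section

namespace Literature.Geometry.Riemannian

open Literature.Analysis.PDE Literature.Analysis.PDE.Parabolic MeasureTheory Set
open scoped ENNReal NNReal Pointwise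

namespace ParabolicFlow

/-! ### Time slices -/

section TimeSlice

variable {E : Type*}

/-- The **time slice** `𝓜(s) = {y : (y, s) ∈ 𝓜}` of a subset of spacetime (White 2005, §2.2:
"the spatial slice `𝓜(t) := {x ∈ R^N : (x, t) ∈ 𝓜}`"). [cite: White2005, §2.2] -/
def timeSlice (S : Set (Parabolic E)) (s : ℝ) : Set E :=
  {y | (⟨y, s⟩ : Parabolic E) ∈ S}

/-- Membership in a time slice. [cite: White2005, §2.2] -/
@[simp] theorem mem_timeSlice {S : Set (Parabolic E)} {s : ℝ} {y : E} :
    y ∈ timeSlice S s ↔ (⟨y, s⟩ : Parabolic E) ∈ S := Iff.rfl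

/-- Time slices are monotone in the set. [cite: White2005, §2.2] -/
theorem timeSlice_mono {S S' : Set (Parabolic E)} (h : S ⊆ S') (s : ℝ) :
    timeSlice S s ⊆ timeSlice S' s := fun _ hy => h hy

/-- Time slices of a spacetime translate: `(𝓜 + Z)(s) = 𝓜(s - τ(Z)) + z`. [cite: White2005, §2.2] -/
theorem timeSlice_image_add [AddCommGroup E] (S : Set (Parabolic E)) (Z : Parabolic E) (s : ℝ) :
    timeSlice ((· + Z) '' S) s = (· + Z.x) '' timeSlice S (s - Z.t) := by
  ext y
  simp only [mem_timeSlice, mem_image]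
  constructor
  · rintro ⟨W, hW, hWy⟩
    have hx : W.x + Z.x = y := by simpa using congrArg Parabolic.x hWy
    have ht : W.t + Z.t = s := by simpa using congrArg Parabolic.t hWy
    refine ⟨W.x, ?_, hx⟩
    have hW' : W = ⟨W.x, s - Z.t⟩ := Parabolic.ext rfl (by show W.t = s - Z.t; linarith)
    rwa [← hW']
  · rintro ⟨w, hw, rfl⟩
    exact ⟨⟨w, s - Z.t⟩, hw, Parabolic.ext rfl (by simp)⟩

/-- Time slices of `𝓜 - Z`: `(𝓜 - Z)(s) = 𝓜(s + τ(Z)) - z`. [cite: White2005, §2.2] -/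
theorem timeSlice_image_sub [AddCommGroup E] (S : Set (Parabolic E)) (Z : Parabolic E) (s : ℝ) :
    timeSlice ((· - Z) '' S) s = (· - Z.x) '' timeSlice S (s + Z.t) := by
  have h := timeSlice_image_add S (-Z) s
  simp only [neg_x, neg_t, sub_neg_eq_add, ← sub_eq_add_neg] at h
  exact h

/-- Time slices of a parabolic dilate: `(D_c 𝓜)(s) = c • 𝓜(s / c²)` (`c ≠ 0`).
[cite: White2005, §2.1] -/
theorem timeSlice_image_dilation [NormedAddCommGroup E] [NormedSpace ℝ E] (S : Set (Parabolic E))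
    {c : ℝ} (hc : c ≠ 0) (s : ℝ) :
    timeSlice (dilation c '' S) s = c • timeSlice S (s / c ^ 2) := by
  have hc2 : c ^ 2 ≠ 0 := pow_ne_zero 2 hc
  ext y
  rw [mem_timeSlice, mem_image, Set.mem_smul_set_iff_inv_smul_mem₀ hc, mem_timeSlice]
  constructor
  · rintro ⟨W, hW, hWy⟩
    have hx : c • W.x = y := by simpa using congrArg Parabolic.x hWy
    have ht : c ^ 2 * W.t = s := by simpa using congrArg Parabolic.t hWy
    have hW' : W = ⟨c⁻¹ • y, s / c ^ 2⟩ := by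
      refine Parabolic.ext ?_ ?_
      · show W.x = c⁻¹ • y
        rw [← hx, smul_smul, inv_mul_cancel₀ hc, one_smul]
      · show W.t = s / c ^ 2
        rw [← ht]; field_simp
    rwa [← hW']
  · intro h
    refine ⟨⟨c⁻¹ • y, s / c ^ 2⟩, h, Parabolic.ext ?_ ?_⟩
    · show c • (c⁻¹ • y) = y
      rw [smul_smul, mul_inv_cancel₀ hc, one_smul]
    · show c ^ 2 * (s / c ^ 2) = s
      field_simp

end TimeSlice

/-! ### The Gaussian density ratio -/

section Density

variable {N : ℕ}

/-- **White's Gaussian density ratio** `Θ(𝓜, X, r) = ∫_{𝓜(t - r²)} ρ_X(·, t - r²) d𝓗^m`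
(White 2005, §2.9) of a subset `𝓜 ⊆ R^{N,1}` at `X = (x, t)` and radius `r`, written with the
tree's Gaussian area: `(4π r²)^{-m/2} ∫_{𝓜(t - r²)} exp(-|y - x|²/4r²) d𝓗^m(y)`.
[cite: White2005, §2.9] -/
def gaussianDensityRatio (m : ℕ) (S : Set (Parabolic (EuclideanSpace ℝ (Fin N))))
    (X : Parabolic (EuclideanSpace ℝ (Fin N))) (r : ℝ) : ℝ≥0∞ :=
  gaussianArea m X.x (r ^ 2) (timeSlice S (X.t - r ^ 2))

/-- Unfolding `Θ`. [cite: White2005, §2.9] -/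
theorem gaussianDensityRatio_eq (m : ℕ) (S : Set (Parabolic (EuclideanSpace ℝ (Fin N))))
    (X : Parabolic (EuclideanSpace ℝ (Fin N))) (r : ℝ) :
    gaussianDensityRatio m S X r = gaussianArea m X.x (r ^ 2) (timeSlice S (X.t - r ^ 2)) := rfl

/-- `Θ` is monotone in the set. [cite: White2005, §2.9] -/
theorem gaussianDensityRatio_mono (m : ℕ) {S S' : Set (Parabolic (EuclideanSpace ℝ (Fin N)))}
    (h : S ⊆ S') (X : Parabolic (EuclideanSpace ℝ (Fin N))) (r : ℝ) :
    gaussianDensityRatio m S X r ≤ gaussianDensityRatio m S' X r :=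
  gaussianArea_mono m X.x (r ^ 2) (timeSlice_mono h _)

/-- **Translation invariance**: `Θ(𝓜 + Z, X + Z, r) = Θ(𝓜, X, r)`. [cite: White2005, §2.9] -/
theorem gaussianDensityRatio_image_add_right (m : ℕ)
    (S : Set (Parabolic (EuclideanSpace ℝ (Fin N)))) (X Z : Parabolic (EuclideanSpace ℝ (Fin N)))
    (r : ℝ) : gaussianDensityRatio m ((· + Z) '' S) (X + Z) r = gaussianDensityRatio m S X r := by
  rw [gaussianDensityRatio_eq, gaussianDensityRatio_eq, timeSlice_image_add, add_x, add_t,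
    show X.t + Z.t - r ^ 2 - Z.t = X.t - r ^ 2 by ring]
  have h : (IsometryEquiv.addRight Z.x) '' timeSlice S (X.t - r ^ 2) =
      (· + Z.x) '' timeSlice S (X.t - r ^ 2) := rfl
  rw [← h, ← gaussianArea_image_isometryEquiv (IsometryEquiv.addRight Z.x) m X.x (r ^ 2)]
  rfl

/-- `Θ(𝓜 - Z, X - Z, r) = Θ(𝓜, X, r)`; in particular `Θ(𝓜 - X, 0, r) = Θ(𝓜, X, r)`.
[cite: White2005, §2.9] -/
theorem gaussianDensityRatio_image_sub_right (m : ℕ)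
    (S : Set (Parabolic (EuclideanSpace ℝ (Fin N)))) (X Z : Parabolic (EuclideanSpace ℝ (Fin N)))
    (r : ℝ) : gaussianDensityRatio m ((· - Z) '' S) (X - Z) r = gaussianDensityRatio m S X r := by
  have h := gaussianDensityRatio_image_add_right m S X (-Z) r
  simp only [← sub_eq_add_neg] at h
  exact h

/-- **Scale invariance**: `Θ(D_c 𝓜, D_c X, c r) = Θ(𝓜, X, r)` for `c > 0`, `r ≠ 0` (White 2005,
§2.9; the slice `(D_c 𝓜)(c²t - c²r²) = c • 𝓜(t - r²)` and `F_{c x, c² r²}(c A) = F_{x, r²}(A)`).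
[cite: White2005, §2.9] -/
theorem gaussianDensityRatio_image_dilation (m : ℕ)
    (S : Set (Parabolic (EuclideanSpace ℝ (Fin N)))) (X : Parabolic (EuclideanSpace ℝ (Fin N)))
    {c r : ℝ} (hc : 0 < c) (hr : r ≠ 0) :
    gaussianDensityRatio m (dilation c '' S) (dilation c X) (c * r) =
      gaussianDensityRatio m S X r := by
  have hc0 : c ≠ 0 := hc.ne'
  rw [gaussianDensityRatio_eq, gaussianDensityRatio_eq, timeSlice_image_dilation S hc0,
    dilation_x,
    dilation_t, show (c ^ 2 * X.t - (c * r) ^ 2) / c ^ 2 = X.t - r ^ 2 by field_simp,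
    show (c * r) ^ 2 = c ^ 2 * r ^ 2 by ring]
  exact gaussianArea_smul hc0 m X.x (by positivity) _

/-- **The density ratios of the spacetime track of a family `F`**: for
`𝓜 = {(F s y, s) : s ∈ I}`, `Θ(𝓜, (x, t), r) = gaussianArea m x (r²) (range (F (t - r²)))`
whenever `t - r² ∈ I` — the quantity bounded in the density hypothesis of the fact
`White2005_localRegularity_cylinderFlowSheet`. [cite: White2005, §2.9] -/
theorem gaussianDensityRatio_track {M : Type*} (m : ℕ) (F : ℝ → M → EuclideanSpace ℝ (Fin N))
    (I : Set ℝ) {X : Parabolic (EuclideanSpace ℝ (Fin N))} {r : ℝ} (h : X.t - r ^ 2 ∈ I) :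
    gaussianDensityRatio m {Y | ∃ s ∈ I, ∃ y : M, Y = ⟨F s y, s⟩} X r =
      gaussianArea m X.x (r ^ 2) (Set.range (F (X.t - r ^ 2))) := by
  rw [gaussianDensityRatio_eq]
  congr 1
  ext z
  simp only [mem_timeSlice, mem_setOf_eq, mem_range]
  constructor
  · rintro ⟨s, -, y, hy⟩
    have hs : s = X.t - r ^ 2 := (congrArg Parabolic.t hy).symm
    subst hs
    exact ⟨y, (congrArg Parabolic.x hy).symm⟩
  · rintro ⟨y, rfl⟩
    exact ⟨X.t - r ^ 2, h, y, rfl⟩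

end Density

/-! ### Static planes have density ratios `≤ 1`, `= 1` at their points -/

section StaticPlane

variable {N : ℕ}

/-- Time slices of a static set `S × J` at times in `J` are `S`. [cite: White2005, §2.2] -/
theorem timeSlice_prod_of_mem (S : Set (EuclideanSpace ℝ (Fin N))) {J : Set ℝ} {s : ℝ}
    (hs : s ∈ J) :
    timeSlice {Y : Parabolic (EuclideanSpace ℝ (Fin N)) | Y.x ∈ S ∧ Y.t ∈ J} s = S := by
  ext y
  simp [hs]

/-- Time slices of a static set `S × J` at times outside `J` are empty. [cite: White2005, §2.2] -/
theorem timeSlice_prod_of_not_mem (S : Set (EuclideanSpace ℝ (Fin N))) {J : Set ℝ} {s : ℝ}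
    (hs : s ∉ J) :
    timeSlice {Y : Parabolic (EuclideanSpace ℝ (Fin N)) | Y.x ∈ S ∧ Y.t ∈ J} s = ∅ := by
  ext y
  simp [hs]

/-- **A static `m`-plane has Gaussian density ratios `≤ 1`**: for `𝓜 = S × J` with `S` an affine
`m`-plane, `Θ(𝓜, X, r) ≤ 1` for every `X` and `r > 0` (`= F_{x, r²}(S) = e^{-dist(x, S)²/4r²}` at
admissible times, `0` otherwise). [cite: White2005, §2.10] -/
theorem gaussianDensityRatio_staticPlane_le_one {m : ℕ}
    (S : AffineSubspace ℝ (EuclideanSpace ℝ (Fin N))) [Nonempty S] (hS : Module.finrank ℝ S.direction = m) (J : Set ℝ)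
    (X : Parabolic (EuclideanSpace ℝ (Fin N))) {r : ℝ} (hr : r ≠ 0) :
    gaussianDensityRatio m {Y : Parabolic (EuclideanSpace ℝ (Fin N)) | Y.x ∈ (S : Set _) ∧ Y.t ∈ J}
      X r ≤ 1 := by
  rw [gaussianDensityRatio_eq]
  by_cases h : X.t - r ^ 2 ∈ J
  · rw [timeSlice_prod_of_mem _ h]
    exact gaussianArea_affineSubspace_le_one S hS X.x (by positivity)
  · rw [timeSlice_prod_of_not_mem _ h, gaussianArea_empty]
    exact zero_le_one

/-- **A static `m`-plane has Gaussian density ratio `1` at its points**: for `𝓜 = S × J` and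
`X = (x, t)` with `x ∈ S`, `t - r² ∈ J`, `Θ(𝓜, X, r) = 1` — the model of White's rigidity
statement §2.10 (`Θ ≡ 1` characterises static multiplicity-one planes among proper mean curvature
flows). [cite: White2005, §2.10] -/
theorem gaussianDensityRatio_staticPlane_eq_one {m : ℕ}
    (S : AffineSubspace ℝ (EuclideanSpace ℝ (Fin N))) [FiniteDimensional ℝ S.direction]
    (hS : Module.finrank ℝ S.direction = m) (J : Set ℝ) {X : Parabolic (EuclideanSpace ℝ (Fin N))}
    (hX : X.x ∈ S) {r : ℝ} (hr : r ≠ 0) (hJ : X.t - r ^ 2 ∈ J) :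
    gaussianDensityRatio m {Y : Parabolic (EuclideanSpace ℝ (Fin N)) | Y.x ∈ (S : Set _) ∧ Y.t ∈ J}
      X r = 1 := by
  rw [gaussianDensityRatio_eq, timeSlice_prod_of_mem _ hJ]
  exact gaussianArea_affineSubspace_of_mem S hS hX (by positivity)

end StaticPlane

end ParabolicFlow

end Literature.Geometry.Riemannian
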